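import Mathlib
import Literature.Probability.RandomMatrix.LovasAndaiTheorem2Kernel
import Literature.Probability.RandomMatrix.TwoQubitSeparabilityVolumesRebitFibreReduction
import Literature.Probability.RandomMatrix.TwoQubitSeparabilityVolumesRebitFullProofs

/-!
# Lovas–Andai 2017, Theorem 2 with Corollary 2 — the two-rebit separability probability `29/64`
# (the change of variables to the rapidity kernel, and the discharge of the two named rebit facts)

Sibling proof file of `Literature/Probability/RandomMatrix/TwoQubitSeparabilityVolumes.lean`:
`LovasAndai2017_rebit_fibre_separability_probability_holds` (the fibre over the maximally mixed
marginal) and `LovasAndai2017_rebit_separability_probability_holds` (the entry chart `ℝ⁹`),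
statements unchanged; theorem-only (no definitions, no new facts).

The analytic part of [LovasAndai2017, proof of Theorem 2] in the tree is
`LovasAndai2017.integral_chiTilde_mul_dens_eq` (`LovasAndaiTheorem2Kernel.lean`):
`∫₀^∞ χ̃₁(e^{−γ}) dens(γ) dγ = (29/64) ∫₀^∞ dens`, `dens γ = 4 sinh γ · Y₅(γ)`,
`Y₅(γ) = ∫_ℝ dθ/(cosh θ + cosh γ)⁵`. The geometric part
(`TwoQubitSeparabilityVolumesRebitFibreReduction.lean`,
`rebit_fibre_separability_probability_of_eigenIntegral`: Schur `Z`-sections, `χ₁`,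
polar/eigenvalue coordinates — Theorem 1 and Corollary 2 of the source at `D = ½·1`) reduces the
fibre fact to an identity between two integrals over the ordered eigenvalue pairs `0 < b < a < ½`
of `X` with the weight `(a−b)ab(½−a)(½−b)`. This file supplies the substitution linking the two
(`lintegral_pairFun_eq_dens`): for every measurable `G ≥ 0`,

  `∫∫_{0<b<a<½} (a−b)ab(½−a)(½−b) G(√(b(½−a)/(a(½−b)))) da db = (1/4096) ∫₀^∞ dens(γ) G(e^{−γ}) dγ`,

obtained as in the printed proof — `a = (1+x)/4`, `b = (1+y)/4`; `x = tanh α`, `y = tanh β` (so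
the weight becomes `sinh(α−β) sech⁵α sech⁵β` and `ε = e^{−(α−β)}`; the source writes this as
`u = (1−x)/(1+x) = e^{−2α}`, `v = (1−y)/(1+y)`, `u = ts`, `v = s/t`); `γ = α − β`; and the
`β`-integral `∫ sech⁵(β+γ) sech⁵β dβ = 16 Y₅(γ)` by `cosh(β+γ) cosh β = (cosh(2β+γ) + cosh γ)/2` —
with every step a one-dimensional substitution inside a Tonelli iterated integral. Then
`eigenPair_identity` (`64 ∫∫ w χ₁(ε) = 29 ∫∫ w χ₁(1)`, using `χ₁ = χ₁(1)·χ̃₁` from Lemma 6) and the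
two `_holds`, the last via `LovasAndai2017.rebit_separability_probability_of_fibre`
(`TwoQubitSeparabilityVolumesRebitFullProofs.lean`, Corollary 2 = Milz–Strunz invariance).
-/

noncomputable section

open MeasureTheory Real Set Filter
open scoped ENNReal Topology

namespace Literature.Probability.RandomMatrix
namespace LovasAndai

/-! ### One-dimensional substitutions for `∫⁻` -/

/-- Affine substitution: `∫ h(c·x + d) dx = |c|⁻¹ ∫ h` (`c ≠ 0`). [folklore] -/
theorem lintegral_comp_mul_add {c : ℝ} (hc : c ≠ 0) (d : ℝ) (h : ℝ → ℝ≥0∞) :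
    ∫⁻ x, h (c * x + d) = ENNReal.ofReal |c⁻¹| * ∫⁻ x, h x := by
  set e := (Homeomorph.mulLeft₀ c hc).toMeasurableEquiv with he
  have h1 : ∫⁻ x, h (c * x + d) = ∫⁻ y, h (y + d) ∂(Measure.map e volume) :=
    (lintegral_map_equiv (fun y => h (y + d)) e).symm
  have h2 : (Measure.map e volume : Measure ℝ) = Measure.map (fun x => c * x) volume := rfl
  rw [h1, h2, Real.map_volume_mul_left hc, lintegral_smul_measure, lintegral_add_right_eq_self h d,
    smul_eq_mul]

/-- The derivative of `tanh`. [folklore] -/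
theorem hasDerivAt_tanh (x : ℝ) : HasDerivAt tanh ((cosh x ^ 2)⁻¹) x := by
  have hc : cosh x ≠ 0 := (cosh_pos x).ne'
  have h := (hasDerivAt_sinh x).div (hasDerivAt_cosh x) hc
  have e : (sinh / cosh : ℝ → ℝ) = tanh := by funext y; exact (tanh_eq_sinh_div_cosh y).symm
  rw [e] at h
  refine h.congr_deriv ?_
  rw [show cosh x * cosh x - sinh x * sinh x = 1 from by
    linear_combination cosh_sq_sub_sinh_sq x, one_div]

/-- The `tanh` substitution: `∫_{(-1,1)} h = ∫_ℝ sech²α · h(tanh α) dα`. [folklore] -/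
theorem lintegral_Ioo_eq_lintegral_tanh (h : ℝ → ℝ≥0∞) :
    ∫⁻ x in Ioo (-1 : ℝ) 1, h x = ∫⁻ α, ENNReal.ofReal ((cosh α ^ 2)⁻¹) * h (tanh α) := by
  have himg : tanh '' univ = Ioo (-1 : ℝ) 1 := tanh_bijOn.image_eq
  rw [← himg, lintegral_image_eq_lintegral_abs_deriv_mul MeasurableSet.univ
    (fun x _ => (hasDerivAt_tanh x).hasDerivWithinAt) (fun x _ y _ hxy => tanh_injective hxy),
    Measure.restrict_univ]
  congr 1; funext α
  rw [abs_of_pos (by positivity)]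


/-- `tanh` is strictly monotone. [folklore] -/
theorem tanh_lt_tanh_iff {a b : ℝ} : tanh a < tanh b ↔ a < b := by
  have ha : tanh a ∈ Ioo (-1 : ℝ) 1 := tanh_bijOn.mapsTo (mem_univ a)
  have hb : tanh b ∈ Ioo (-1 : ℝ) 1 := tanh_bijOn.mapsTo (mem_univ b)
  rw [← artanh_lt_artanh_iff ha hb, artanh_tanh, artanh_tanh]

/-- `1 − tanh² = sech²`. [folklore] -/
theorem one_sub_tanh_sq (a : ℝ) : 1 - tanh a ^ 2 = (cosh a ^ 2)⁻¹ := by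
  have hc : cosh a ≠ 0 := (cosh_pos a).ne'
  rw [tanh_eq_sinh_div_cosh]
  field_simp
  linear_combination cosh_sq_sub_sinh_sq a

/-- `(1 + tanh a)/(1 − tanh a) = e^{2a}`. [folklore] -/
theorem one_add_tanh_div (a : ℝ) : (1 + tanh a) / (1 - tanh a) = exp (2 * a) := by
  have hc : cosh a ≠ 0 := (cosh_pos a).ne'
  have h1 : 1 + tanh a = exp a / cosh a := by
    rw [tanh_eq_sinh_div_cosh, ← cosh_add_sinh]; field_simp
  have h2 : 1 - tanh a = exp (-a) / cosh a := by
    rw [tanh_eq_sinh_div_cosh, ← cosh_sub_sinh]; field_simp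
  rw [h1, h2, div_div_div_cancel_right₀ hc, ← exp_sub]
  ring_nf

/-- `e^{2u} = (e^u)²`. [folklore] -/
theorem exp_mul_two_eq_sq (u : ℝ) : exp (2 * u) = exp u ^ 2 := by
  rw [show 2 * u = u + u by ring, exp_add, sq]

/-! ### The eigenvalue-pair integral in the coordinates `(x, y)` and `(α, β)` -/

/-- The set of ordered eigenvalue pairs `0 < b < a < ½` is measurable. [folklore] -/
theorem measurableSet_pairSet : MeasurableSet {p : ℝ × ℝ | 0 < p.2 ∧ p.2 < p.1 ∧ p.1 < 1 / 2} :=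
  (measurableSet_lt measurable_const measurable_snd).inter
    ((measurableSet_lt measurable_snd measurable_fst).inter
      (measurableSet_lt measurable_fst measurable_const))

/-- Measurability of the eigenvalue-pair integrand. [folklore] -/
theorem measurable_pairFun {G : ℝ → ℝ≥0∞} (hG : Measurable G) :
    Measurable ({p : ℝ × ℝ | 0 < p.2 ∧ p.2 < p.1 ∧ p.1 < 1 / 2}.indicator (fun p : ℝ × ℝ => ENNReal.ofReal ((p.1 - p.2) * (p.1 * p.2 * ((1 / 2 - p.1) * (1 / 2 - p.2)))) * G (√(p.2 * (1 / 2 - p.1) / (p.1 * (1 / 2 - p.2)))))) := by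
  refine Measurable.indicator ?_ measurableSet_pairSet
  exact (ENNReal.measurable_ofReal.comp (by fun_prop)).mul (hG.comp (by fun_prop))

/-- The eigenvalue-pair integrand at `a = (1+x)/4`, `b = (1+y)/4` is
`𝟙{−1<y<x<1} (x−y)(1−x²)(1−y²)/1024 · G(√((1+y)(1−x)/((1+x)(1−y))))`.
[cite: LovasAndai2017, proof of Theorem 2 (first display)] -/
theorem pairFun_affine (G : ℝ → ℝ≥0∞) (x y : ℝ) :
    ({p : ℝ × ℝ | 0 < p.2 ∧ p.2 < p.1 ∧ p.1 < 1 / 2}.indicator (fun p : ℝ × ℝ => ENNReal.ofReal ((p.1 - p.2) * (p.1 * p.2 * ((1 / 2 - p.1) * (1 / 2 - p.2)))) * G (√(p.2 * (1 / 2 - p.1) / (p.1 * (1 / 2 - p.2)))))) ((1 + x) / 4, (1 + y) / 4) =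
      (if -1 < y ∧ y < x ∧ x < 1 then ENNReal.ofReal ((x - y) * (1 - x ^ 2) * (1 - y ^ 2) / 1024) * G (√((1 + y) * (1 - x) / ((1 + x) * (1 - y)))) else 0) := by
  by_cases h : -1 < y ∧ y < x ∧ x < 1
  · obtain ⟨h1, h2, h3⟩ := h
    have hmem : ((1 + x) / 4, (1 + y) / 4) ∈ {p : ℝ × ℝ | 0 < p.2 ∧ p.2 < p.1 ∧ p.1 < 1 / 2} := by
      simp only [mem_setOf_eq]; refine ⟨by linarith, by linarith, by linarith⟩
    rw [indicator_of_mem hmem, if_pos ⟨h1, h2, h3⟩]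
    have harg : (1 + y) / 4 * (1 / 2 - (1 + x) / 4) / ((1 + x) / 4 * (1 / 2 - (1 + y) / 4)) =
        (1 + y) * (1 - x) / ((1 + x) * (1 - y)) := by
      rw [div_eq_div_iff (mul_ne_zero (by linarith) (by linarith))
        (mul_ne_zero (by linarith) (by linarith))]
      ring
    simp only []
    rw [harg]
    congr 2
    ring
  · have hnmem : ((1 + x) / 4, (1 + y) / 4) ∉ {p : ℝ × ℝ | 0 < p.2 ∧ p.2 < p.1 ∧ p.1 < 1 / 2} := by
      simp only [mem_setOf_eq, not_and]
      intro h1 h2 h3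
      exact h ⟨by linarith, by linarith, by linarith⟩
    rw [indicator_of_notMem hnmem, if_neg h]

/-- Measurability of the `(x, y)`-integrand. [folklore] -/
theorem measurable_xyFun {G : ℝ → ℝ≥0∞} (hG : Measurable G) :
    Measurable fun q : ℝ × ℝ => (if -1 < q.2 ∧ q.2 < q.1 ∧ q.1 < 1 then ENNReal.ofReal ((q.1 - q.2) * (1 - q.1 ^ 2) * (1 - q.2 ^ 2) / 1024) * G (√((1 + q.2) * (1 - q.1) / ((1 + q.1) * (1 - q.2)))) else 0) := by
  have : (fun q : ℝ × ℝ => (if -1 < q.2 ∧ q.2 < q.1 ∧ q.1 < 1 then ENNReal.ofReal ((q.1 - q.2) * (1 - q.1 ^ 2) * (1 - q.2 ^ 2) / 1024) * G (√((1 + q.2) * (1 - q.1) / ((1 + q.1) * (1 - q.2)))) else 0)) =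
      fun q : ℝ × ℝ => ({p : ℝ × ℝ | 0 < p.2 ∧ p.2 < p.1 ∧ p.1 < 1 / 2}.indicator (fun p : ℝ × ℝ => ENNReal.ofReal ((p.1 - p.2) * (p.1 * p.2 * ((1 / 2 - p.1) * (1 / 2 - p.2)))) * G (√(p.2 * (1 / 2 - p.1) / (p.1 * (1 / 2 - p.2)))))) ((1 + q.1) / 4, (1 + q.2) / 4) := by
    funext q; exact (pairFun_affine G q.1 q.2).symm
  rw [this]
  exact (measurable_pairFun hG).comp (by fun_prop)

/-- **Step 1** (`a = (1+x)/4`, `b = (1+y)/4`). [cite: LovasAndai2017, proof of Theorem 2] -/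
theorem lintegral_pairFun_eq_xy {G : ℝ → ℝ≥0∞} (hG : Measurable G) :
    ∫⁻ p, ({p : ℝ × ℝ | 0 < p.2 ∧ p.2 < p.1 ∧ p.1 < 1 / 2}.indicator (fun p : ℝ × ℝ => ENNReal.ofReal ((p.1 - p.2) * (p.1 * p.2 * ((1 / 2 - p.1) * (1 / 2 - p.2)))) * G (√(p.2 * (1 / 2 - p.1) / (p.1 * (1 / 2 - p.2)))))) p =
      ENNReal.ofReal (1 / 16) * ∫⁻ x, ∫⁻ y, (if -1 < y ∧ y < x ∧ x < 1 then ENNReal.ofReal ((x - y) * (1 - x ^ 2) * (1 - y ^ 2) / 1024) * G (√((1 + y) * (1 - x) / ((1 + x) * (1 - y)))) else 0) := by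
  set F : ℝ × ℝ → ℝ≥0∞ := ({p : ℝ × ℝ | 0 < p.2 ∧ p.2 < p.1 ∧ p.1 < 1 / 2}.indicator (fun p : ℝ × ℝ => ENNReal.ofReal ((p.1 - p.2) * (p.1 * p.2 * ((1 / 2 - p.1) * (1 / 2 - p.2)))) * G (√(p.2 * (1 / 2 - p.1) / (p.1 * (1 / 2 - p.2)))))) with hF
  rw [Measure.volume_eq_prod, lintegral_prod _ (measurable_pairFun hG).aemeasurable]
  have hin : ∀ a : ℝ, ∫⁻ b, F (a, b) = ENNReal.ofReal (1 / 4) * ∫⁻ y, F (a, (1 + y) / 4) := by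
    intro a
    have h := lintegral_comp_mul_add (c := 1 / 4) (by norm_num) (1 / 4) (fun b => F (a, b))
    have e : ∀ y : ℝ, 1 / 4 * y + 1 / 4 = (1 + y) / 4 := fun y => by ring
    simp only [e] at h
    rw [h, ← mul_assoc, ← ENNReal.ofReal_mul (by norm_num)]
    norm_num
  change ∫⁻ a, ∫⁻ b, F (a, b) = _
  simp_rw [hin]
  have hf : Measurable fun q : ℝ × ℝ => F (q.1, (1 + q.2) / 4) :=
    (measurable_pairFun hG).comp (by fun_prop)
  have hmeas : Measurable fun a : ℝ => ∫⁻ y, F (a, (1 + y) / 4) := hf.lintegral_prod_right'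
  rw [lintegral_const_mul _ hmeas]
  have hout := lintegral_comp_mul_add (c := 1 / 4) (by norm_num) (1 / 4)
    (fun a => ∫⁻ y, F (a, (1 + y) / 4))
  have e : ∀ x : ℝ, 1 / 4 * x + 1 / 4 = (1 + x) / 4 := fun x => by ring
  simp only [e] at hout
  have hout' : ∫⁻ a, ∫⁻ y, F (a, (1 + y) / 4) =
      ENNReal.ofReal (1 / 4) * ∫⁻ x, ∫⁻ y, F ((1 + x) / 4, (1 + y) / 4) := by
    rw [hout, ← mul_assoc, ← ENNReal.ofReal_mul (by norm_num)]
    norm_num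
  rw [hout', ← mul_assoc, ← ENNReal.ofReal_mul (by norm_num)]
  simp only [hF, pairFun_affine]
  norm_num

/-- The `(x,y)`-integrand at `(tanh α, tanh β)` with the two Jacobians `sech²` is
`𝟙{β<α} sinh(α−β) sech⁵α sech⁵β /1024 · G(e^{−(α−β)})`.
[cite: LovasAndai2017, proof of Theorem 2 (the substitutions u = (1−x)/(1+x), v = (1−y)/(1+y))] -/
theorem xyFun_tanh (G : ℝ → ℝ≥0∞) (α β : ℝ) :
    ENNReal.ofReal ((cosh α ^ 2)⁻¹) * (ENNReal.ofReal ((cosh β ^ 2)⁻¹) *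
      (if -1 < (tanh β) ∧ (tanh β) < (tanh α) ∧ (tanh α) < 1 then ENNReal.ofReal (((tanh α) - (tanh β)) * (1 - (tanh α) ^ 2) * (1 - (tanh β) ^ 2) / 1024) * G (√((1 + (tanh β)) * (1 - (tanh α)) / ((1 + (tanh α)) * (1 - (tanh β))))) else 0)) =
      (if β < α then ENNReal.ofReal (sinh (α - β) / (cosh α ^ 5 * cosh β ^ 5) / 1024) * G (exp (-(α - β))) else 0) := by
  have hα1 : tanh α < 1 := (tanh_bijOn.mapsTo (mem_univ α)).2
  have hβ0 : -1 < tanh β := (tanh_bijOn.mapsTo (mem_univ β)).1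
  by_cases h : β < α
  · rw [if_pos ⟨hβ0, tanh_lt_tanh_iff.mpr h, hα1⟩, if_pos h]
    have hca : cosh α ≠ 0 := (cosh_pos α).ne'
    have hcb : cosh β ≠ 0 := (cosh_pos β).ne'
    have hw : (cosh α ^ 2)⁻¹ * ((cosh β ^ 2)⁻¹ *
        ((tanh α - tanh β) * (1 - tanh α ^ 2) * (1 - tanh β ^ 2) / 1024)) =
        sinh (α - β) / (cosh α ^ 5 * cosh β ^ 5) / 1024 := by
      rw [one_sub_tanh_sq, one_sub_tanh_sq, tanh_eq_sinh_div_cosh, tanh_eq_sinh_div_cosh, sinh_sub]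
      field_simp
    have harg : √((1 + tanh β) * (1 - tanh α) / ((1 + tanh α) * (1 - tanh β))) = exp (-(α - β)) := by
      have e : (1 + tanh β) * (1 - tanh α) / ((1 + tanh α) * (1 - tanh β)) =
          ((1 + tanh β) / (1 - tanh β)) / ((1 + tanh α) / (1 - tanh α)) := by
        rw [div_div_div_eq]; ring
      rw [e, one_add_tanh_div, one_add_tanh_div, ← exp_sub,
        show 2 * β - 2 * α = 2 * -(α - β) by ring, exp_mul_two_eq_sq, Real.sqrt_sq (exp_pos _).le]
    rw [harg, ← mul_assoc, ← mul_assoc, ← ENNReal.ofReal_mul (by positivity),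
      ← ENNReal.ofReal_mul (by positivity), mul_assoc, hw]
  · rw [if_neg h, if_neg (fun hc => h (tanh_lt_tanh_iff.mp hc.2.1)), mul_zero, mul_zero]

/-- The `(x,y)`-integrand vanishes unless `y ∈ (−1, 1)`. [folklore] -/
theorem xyFun_eq_indicator_y (G : ℝ → ℝ≥0∞) (x : ℝ) :
    (fun y => (if -1 < y ∧ y < x ∧ x < 1 then ENNReal.ofReal ((x - y) * (1 - x ^ 2) * (1 - y ^ 2) / 1024) * G (√((1 + y) * (1 - x) / ((1 + x) * (1 - y)))) else 0)) =
      (Ioo (-1 : ℝ) 1).indicator fun y => (if -1 < y ∧ y < x ∧ x < 1 then ENNReal.ofReal ((x - y) * (1 - x ^ 2) * (1 - y ^ 2) / 1024) * G (√((1 + y) * (1 - x) / ((1 + x) * (1 - y)))) else 0) := by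
  funext y
  by_cases hy : y ∈ Ioo (-1 : ℝ) 1
  · rw [indicator_of_mem hy]
  · rw [indicator_of_notMem hy, if_neg]
    rintro ⟨h1, h2, h3⟩
    exact hy ⟨h1, by linarith⟩

/-- The `(x,y)`-integrand vanishes unless `x ∈ (−1, 1)`. [folklore] -/
theorem xyFun_eq_zero_of_x {G : ℝ → ℝ≥0∞} {x : ℝ} (hx : x ∉ Ioo (-1 : ℝ) 1) (y : ℝ) :
    (if -1 < y ∧ y < x ∧ x < 1 then ENNReal.ofReal ((x - y) * (1 - x ^ 2) * (1 - y ^ 2) / 1024) * G (√((1 + y) * (1 - x) / ((1 + x) * (1 - y)))) else 0) = 0 := by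
  rw [if_neg]
  rintro ⟨h1, h2, h3⟩
  exact hx ⟨by linarith, h3⟩

/-- **Step 2** (`x = tanh α`, `y = tanh β`). [cite: LovasAndai2017, proof of Theorem 2] -/
theorem lintegral_xy_eq_ab (G : ℝ → ℝ≥0∞) :
    ∫⁻ x, ∫⁻ y, (if -1 < y ∧ y < x ∧ x < 1 then ENNReal.ofReal ((x - y) * (1 - x ^ 2) * (1 - y ^ 2) / 1024) * G (√((1 + y) * (1 - x) / ((1 + x) * (1 - y)))) else 0) =
      ∫⁻ α, ∫⁻ β, (if β < α then ENNReal.ofReal (sinh (α - β) / (cosh α ^ 5 * cosh β ^ 5) / 1024) * G (exp (-(α - β))) else 0) := by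
  have hin : ∀ x : ℝ, ∫⁻ y, (if -1 < y ∧ y < x ∧ x < 1 then ENNReal.ofReal ((x - y) * (1 - x ^ 2) * (1 - y ^ 2) / 1024) * G (√((1 + y) * (1 - x) / ((1 + x) * (1 - y)))) else 0) =
      ∫⁻ β, ENNReal.ofReal ((cosh β ^ 2)⁻¹) * (if -1 < (tanh β) ∧ (tanh β) < x ∧ x < 1 then ENNReal.ofReal ((x - (tanh β)) * (1 - x ^ 2) * (1 - (tanh β) ^ 2) / 1024) * G (√((1 + (tanh β)) * (1 - x) / ((1 + x) * (1 - (tanh β))))) else 0) := by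
    intro x
    rw [xyFun_eq_indicator_y, lintegral_indicator measurableSet_Ioo, lintegral_Ioo_eq_lintegral_tanh]
  simp_rw [hin]
  set Φ : ℝ → ℝ≥0∞ := fun x => ∫⁻ β, ENNReal.ofReal ((cosh β ^ 2)⁻¹) *
    (if -1 < (tanh β) ∧ (tanh β) < x ∧ x < 1 then ENNReal.ofReal ((x - (tanh β)) * (1 - x ^ 2) * (1 - (tanh β) ^ 2) / 1024) * G (√((1 + (tanh β)) * (1 - x) / ((1 + x) * (1 - (tanh β))))) else 0) with hΦ
  have hΦind : Φ = (Ioo (-1 : ℝ) 1).indicator Φ := by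
    funext x
    by_cases hx : x ∈ Ioo (-1 : ℝ) 1
    · rw [indicator_of_mem hx]
    · rw [indicator_of_notMem hx, hΦ]
      simp only [xyFun_eq_zero_of_x hx, mul_zero, lintegral_zero]
  change ∫⁻ x, Φ x = _
  rw [hΦind, lintegral_indicator measurableSet_Ioo, lintegral_Ioo_eq_lintegral_tanh]
  congr 1; funext α
  rw [hΦ]
  simp only
  rw [← lintegral_const_mul' _ _ ENNReal.ofReal_ne_top]
  congr 1; funext β
  exact xyFun_tanh G α β

/-! ### Step 3: the rapidity `γ = α − β` and the `β`-integral -/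

/-- `cosh α · cosh(α − γ) = (cosh(2α − γ) + cosh γ)/2`. [folklore] -/
theorem cosh_mul_cosh_sub (α γ : ℝ) : cosh α * cosh (α - γ) = (cosh (2 * α - γ) + cosh γ) / 2 := by
  have h1 : cosh (2 * α - γ) = cosh α * cosh (α - γ) + sinh α * sinh (α - γ) := by
    rw [show 2 * α - γ = α + (α - γ) by ring, cosh_add]
  have h2 : cosh γ = cosh α * cosh (α - γ) - sinh α * sinh (α - γ) := by
    rw [show γ = α - (α - γ) by ring, cosh_sub]; ring_nf
  linarith

open LovasAndai2017 in
/-- The `β`-integral: `∫_α sech⁵α sech⁵(α−γ) dα = 16 Y₅(γ)`. [cite: LovasAndai2017, proof of Theorem 2] -/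
theorem lintegral_sech_five_mul (γ : ℝ) :
    ∫⁻ α, ENNReal.ofReal ((cosh α ^ 5 * cosh (α - γ) ^ 5)⁻¹) = ENNReal.ofReal (16 * Y 5 γ) := by
  have hc : 0 ≤ cosh γ := (cosh_pos γ).le
  have e1 : ∀ α : ℝ, (cosh α ^ 5 * cosh (α - γ) ^ 5)⁻¹ = 32 * ((cosh (2 * α - γ) + cosh γ) ^ 5)⁻¹ := by
    intro α
    rw [← mul_pow, cosh_mul_cosh_sub, div_pow]
    field_simp
    norm_num
  simp_rw [e1]
  have h2 := lintegral_comp_mul_add (c := 2) two_ne_zero (-γ)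
    (fun θ => ENNReal.ofReal (32 * ((cosh θ + cosh γ) ^ 5)⁻¹))
  simp only [show ∀ x : ℝ, 2 * x + -γ = 2 * x - γ from fun x => by ring] at h2
  rw [h2]
  have h3 : ∫⁻ θ, ENNReal.ofReal (32 * ((cosh θ + cosh γ) ^ 5)⁻¹) =
      32 * ∫⁻ θ, ENNReal.ofReal (((cosh θ + cosh γ) ^ 5)⁻¹) := by
    rw [← lintegral_const_mul' _ _ (by norm_num : (32 : ℝ≥0∞) ≠ ⊤)]
    congr 1; funext θ
    rw [ENNReal.ofReal_mul (by norm_num)]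
    norm_num
  rw [h3, ← ofReal_integral_eq_lintegral_ofReal (integrable_inv_pow_cosh_add hc (by norm_num))
    (Eventually.of_forall fun θ => inv_nonneg.mpr (pow_nonneg (cosh_add_pos θ hc).le _))]
  rw [show (∫ θ, ((cosh θ + cosh γ) ^ 5)⁻¹) = Y 5 γ from rfl, ← mul_assoc,
    show ENNReal.ofReal |(2 : ℝ)⁻¹| * 32 = ENNReal.ofReal 16 by
      rw [show (32 : ℝ≥0∞) = ENNReal.ofReal 32 by norm_num, ← ENNReal.ofReal_mul (by positivity)]
      norm_num,
    ← ENNReal.ofReal_mul (by norm_num)]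

/-- Measurability of the `(α, β)`-integrand after the shear `β = α − γ`. [folklore] -/
theorem measurable_abFun_shear {G : ℝ → ℝ≥0∞} (hG : Measurable G) :
    Measurable fun q : ℝ × ℝ => (if (q.1 - q.2) < q.1 then ENNReal.ofReal (sinh (q.1 - (q.1 - q.2)) / (cosh q.1 ^ 5 * cosh (q.1 - q.2) ^ 5) / 1024) * G (exp (-(q.1 - (q.1 - q.2)))) else 0) := by
  refine Measurable.ite ?_ ?_ measurable_const
  · exact measurableSet_lt (measurable_fst.sub measurable_snd) measurable_fst
  · exact (ENNReal.measurable_ofReal.comp (by fun_prop)).mul (hG.comp (by fun_prop))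

open LovasAndai2017 in
/-- **Step 3** (`γ = α − β`, Tonelli, and the `β`-integral):
`∫_α ∫_β 𝟙{β<α} sinh(α−β) sech⁵α sech⁵β/1024 · G(e^{−(α−β)}) = (1/256) ∫_{γ>0} dens(γ) G(e^{−γ}) dγ`.
[cite: LovasAndai2017, proof of Theorem 2] -/
theorem lintegral_ab_eq_dens {G : ℝ → ℝ≥0∞} (hG : Measurable G) :
    ∫⁻ α, ∫⁻ β, (if β < α then ENNReal.ofReal (sinh (α - β) / (cosh α ^ 5 * cosh β ^ 5) / 1024) * G (exp (-(α - β))) else 0) =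
      ENNReal.ofReal (1 / 256) * ∫⁻ γ in Ioi 0, ENNReal.ofReal (dens γ) * G (exp (-γ)) := by
  set A : ℝ → ℝ → ℝ≥0∞ := fun α β => (if β < α then ENNReal.ofReal (sinh (α - β) / (cosh α ^ 5 * cosh β ^ 5) / 1024) * G (exp (-(α - β))) else 0) with hA
  -- reflection–translation invariance `∫ f(α − γ) dγ = ∫ f` is Mathlib's `lintegral_sub_left_eq_self`
  have h1 : ∀ α : ℝ, ∫⁻ β, A α β = ∫⁻ γ, A α (α - γ) := fun α =>
    (lintegral_sub_left_eq_self (A α) α).symm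
  change ∫⁻ α, ∫⁻ β, A α β = _
  simp_rw [h1]
  rw [lintegral_lintegral_swap (measurable_abFun_shear hG).aemeasurable]
  have h2 : ∀ γ α : ℝ, A α (α - γ) = (Ioi (0 : ℝ)).indicator (fun γ =>
      (ENNReal.ofReal (sinh γ / 1024) * G (exp (-γ))) *
        ENNReal.ofReal ((cosh α ^ 5 * cosh (α - γ) ^ 5)⁻¹)) γ := by
    intro γ α
    rw [hA]
    simp only [sub_sub_cancel]
    by_cases hγ : 0 < γ
    · rw [if_pos (by linarith), indicator_of_mem (mem_Ioi.mpr hγ)]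
      have hs : (0 : ℝ) ≤ sinh γ / 1024 := div_nonneg (sinh_pos_iff.mpr hγ).le (by norm_num)
      rw [mul_right_comm, ← ENNReal.ofReal_mul hs]
      congr 2; field_simp
    · rw [if_neg (by linarith), indicator_of_notMem (by simpa using hγ)]
  simp_rw [h2]
  have h3 : ∀ γ : ℝ, ∫⁻ α, (Ioi (0 : ℝ)).indicator (fun γ =>
      (ENNReal.ofReal (sinh γ / 1024) * G (exp (-γ))) *
        ENNReal.ofReal ((cosh α ^ 5 * cosh (α - γ) ^ 5)⁻¹)) γ =
      (Ioi (0 : ℝ)).indicator (fun γ =>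
        (ENNReal.ofReal (sinh γ / 1024) * G (exp (-γ))) * ENNReal.ofReal (16 * Y 5 γ)) γ := by
    intro γ
    by_cases hγ : γ ∈ Ioi (0 : ℝ)
    · simp only [indicator_of_mem hγ]
      rw [lintegral_const_mul'' _ (by fun_prop : Measurable fun α : ℝ =>
        ENNReal.ofReal ((cosh α ^ 5 * cosh (α - γ) ^ 5)⁻¹)).aemeasurable, lintegral_sech_five_mul]
    · simp only [indicator_of_notMem hγ, lintegral_zero]
  simp_rw [h3]
  rw [lintegral_indicator measurableSet_Ioi, ← lintegral_const_mul' _ _ ENNReal.ofReal_ne_top]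
  refine setLIntegral_congr_fun measurableSet_Ioi fun γ hγ => ?_
  have hs : 0 ≤ sinh γ := (sinh_pos_iff.mpr hγ).le
  have hY : 0 ≤ Y 5 γ := Y_nonneg 5 γ
  rw [mul_right_comm, ← ENNReal.ofReal_mul (by positivity),
    show ENNReal.ofReal (1 / 256) * (ENNReal.ofReal (dens γ) * G (exp (-γ))) =
      ENNReal.ofReal (1 / 256 * dens γ) * G (exp (-γ)) by
        rw [← mul_assoc, ← ENNReal.ofReal_mul (by norm_num)]]
  congr 2
  simp only [dens]
  ring

/-- **The substitution** linking the eigenvalue-pair integral to the rapidity kernel: for every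
measurable `G ≥ 0`,
`∫∫_{0<b<a<½} (a−b)ab(½−a)(½−b) G(√(b(½−a)/(a(½−b)))) = (1/4096) ∫_{γ>0} dens(γ) G(e^{−γ}) dγ`.
[cite: LovasAndai2017, Theorem 2 (proof: the substitutions u = (1−x)/(1+x), v = (1−y)/(1+y), u = ts, v = s/t)] -/
theorem lintegral_pairFun_eq_dens {G : ℝ → ℝ≥0∞} (hG : Measurable G) :
    ∫⁻ p, ({p : ℝ × ℝ | 0 < p.2 ∧ p.2 < p.1 ∧ p.1 < 1 / 2}.indicator (fun p : ℝ × ℝ => ENNReal.ofReal ((p.1 - p.2) * (p.1 * p.2 * ((1 / 2 - p.1) * (1 / 2 - p.2)))) * G (√(p.2 * (1 / 2 - p.1) / (p.1 * (1 / 2 - p.2)))))) p =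
      ENNReal.ofReal (1 / 4096) * ∫⁻ γ in Ioi 0, ENNReal.ofReal (LovasAndai2017.dens γ) * G (exp (-γ)) := by
  rw [lintegral_pairFun_eq_xy hG, lintegral_xy_eq_ab, lintegral_ab_eq_dens hG, ← mul_assoc,
    ← ENNReal.ofReal_mul (by norm_num)]
  norm_num

end LovasAndai

namespace LovasAndai

open LovasAndai2017 LovasAndaiLemma6

/-- `χ₁(e) ≤ χ₁(1)` (the second condition only shrinks the ball). [cite: LovasAndai2017, Definition 1] -/
theorem lovasAndaiChiOne_le_one (e : ℝ) : lovasAndaiChiOne e ≤ lovasAndaiChiOne 1 := by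
  rw [lovasAndaiChiOne_eq_volume_normSet, lovasAndaiChiOne_eq_volume_normSet, normSet_one]
  exact measure_mono fun z hz => hz.1

/-- `χ₁(e)` is finite. [folklore] -/
theorem lovasAndaiChiOne_ne_top (e : ℝ) : lovasAndaiChiOne e ≠ ⊤ := by
  rw [lovasAndaiChiOne_eq_volume_normSet]; exact (volume_normSet_lt_top e).ne

/-- `χ₁(1).toReal = 2π²/3 > 0`. [cite: LovasAndai2017, §5 (χ₁(1) = 2π²/3)] -/
theorem toReal_lovasAndaiChiOne_one : (lovasAndaiChiOne 1).toReal = 2 / 3 * π ^ 2 := by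
  rw [lovasAndaiChiOne_one, ENNReal.toReal_ofReal (by positivity)]

/-- The rapidity integral with `χ₁`:
`∫⁻_{γ>0} dens(γ) χ₁(e^{−γ}) = ofReal (χ₁(1) · (29/64) · ∫₀^∞ dens)`.
[cite: LovasAndai2017, Theorem 2 (proof)] -/
theorem lintegral_dens_mul_chiOne :
    ∫⁻ γ in Ioi 0, ENNReal.ofReal (dens γ) * lovasAndaiChiOne (exp (-γ)) =
      ENNReal.ofReal ((lovasAndaiChiOne 1).toReal * (29 / 64 * ∫ γ in Ioi 0, dens γ)) := by
  set c₁ := (lovasAndaiChiOne 1).toReal with hc₁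
  have hc₁pos : 0 < c₁ := by rw [hc₁, toReal_lovasAndaiChiOne_one]; positivity
  -- Step 1: the integrand as `ofReal` of a real function
  have h1 : ∀ γ ∈ Ioi (0 : ℝ), ENNReal.ofReal (dens γ) * lovasAndaiChiOne (exp (-γ)) =
      ENNReal.ofReal (dens γ * (lovasAndaiChiOne (exp (-γ))).toReal) := by
    intro γ hγ
    rw [ENNReal.ofReal_mul (dens_nonneg (le_of_lt hγ)), ENNReal.ofReal_toReal (lovasAndaiChiOne_ne_top _)]
  rw [setLIntegral_congr_fun measurableSet_Ioi h1]
  -- Step 2: integrability (dens integrable, the other factor bounded by c₁ and measurable)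
  have hmeas : AEStronglyMeasurable (fun γ : ℝ => (lovasAndaiChiOne (exp (-γ))).toReal)
      (volume.restrict (Ioi 0)) :=
    (ENNReal.measurable_toReal.comp (measurable_lovasAndaiChiOne.comp (by fun_prop))).aestronglyMeasurable
  have hbdd : ∀ γ : ℝ, ‖(lovasAndaiChiOne (exp (-γ))).toReal‖ ≤ c₁ := by
    intro γ
    rw [Real.norm_eq_abs, abs_of_nonneg ENNReal.toReal_nonneg, hc₁]
    exact ENNReal.toReal_mono (lovasAndaiChiOne_ne_top 1) (lovasAndaiChiOne_le_one _)
  have hint : IntegrableOn (fun γ => dens γ * (lovasAndaiChiOne (exp (-γ))).toReal) (Ioi 0) :=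
    integrableOn_dens.mul_bdd hmeas (Eventually.of_forall hbdd)
  have hnn : 0 ≤ᵐ[volume.restrict (Ioi 0)] fun γ => dens γ * (lovasAndaiChiOne (exp (-γ))).toReal := by
    rw [Filter.EventuallyLE, ae_restrict_iff' measurableSet_Ioi]
    exact Eventually.of_forall fun γ hγ => mul_nonneg (dens_nonneg (le_of_lt hγ)) ENNReal.toReal_nonneg
  rw [← ofReal_integral_eq_lintegral_ofReal hint hnn]
  congr 1
  -- Step 3: `χ₁(e) = χ₁(1) · χ̃₁(e)` on `(0,1)` and the kernel identity
  have h2 : ∀ γ ∈ Ioi (0 : ℝ), dens γ * (lovasAndaiChiOne (exp (-γ))).toReal =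
      c₁ * (chiTilde (exp (-γ)) * dens γ) := by
    intro γ hγ
    have he0 : 0 < exp (-γ) := exp_pos _
    have he1 : exp (-γ) ≤ 1 := by rw [exp_le_one_iff]; exact neg_nonpos.mpr (le_of_lt hγ)
    rw [chiTilde_eq_div he0 he1, ← hc₁]
    field_simp
  rw [setIntegral_congr_fun measurableSet_Ioi h2, integral_const_mul, integral_chiTilde_mul_dens_eq]

/-- The rapidity integral with the constant `χ₁(1)`:
`∫⁻_{γ>0} dens(γ) χ₁(1) = ofReal (χ₁(1) · ∫₀^∞ dens)`. [cite: LovasAndai2017, Theorem 2 (proof)] -/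
theorem lintegral_dens_mul_chiOne_one :
    ∫⁻ γ in Ioi 0, ENNReal.ofReal (dens γ) * lovasAndaiChiOne 1 =
      ENNReal.ofReal ((lovasAndaiChiOne 1).toReal * ∫ γ in Ioi 0, dens γ) := by
  rw [lintegral_mul_const' _ _ (lovasAndaiChiOne_ne_top 1),
    ← ofReal_integral_eq_lintegral_ofReal integrableOn_dens, mul_comm,
    ← ENNReal.ofReal_toReal (lovasAndaiChiOne_ne_top 1), ← ENNReal.ofReal_mul ENNReal.toReal_nonneg,
    ENNReal.toReal_ofReal ENNReal.toReal_nonneg]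
  rw [Filter.EventuallyLE, ae_restrict_iff' measurableSet_Ioi]
  exact Eventually.of_forall fun γ hγ => dens_nonneg (le_of_lt hγ)

/-- **The eigenvalue-pair identity** [LovasAndai2017, proof of Theorem 2, "`(16/35 − 1/4)/(16/35) = 29/64`"]:
`64 ∫∫_{0<b<a<½} w χ₁(ε) = 29 ∫∫_{0<b<a<½} w χ₁(1)`. [cite: LovasAndai2017, Theorem 2 (proof)] -/
theorem eigenPair_identity :
    64 * ∫⁻ p, ({p : ℝ × ℝ | 0 < p.2 ∧ p.2 < p.1 ∧ p.1 < 1 / 2}.indicator (fun p : ℝ × ℝ => ENNReal.ofReal ((p.1 - p.2) * (p.1 * p.2 * ((1 / 2 - p.1) * (1 / 2 - p.2)))) * lovasAndaiChiOne (√(p.2 * (1 / 2 - p.1) / (p.1 * (1 / 2 - p.2)))))) p =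
      29 * ∫⁻ p, ({p : ℝ × ℝ | 0 < p.2 ∧ p.2 < p.1 ∧ p.1 < 1 / 2}.indicator (fun p : ℝ × ℝ => ENNReal.ofReal ((p.1 - p.2) * (p.1 * p.2 * ((1 / 2 - p.1) * (1 / 2 - p.2)))) * (fun _ => lovasAndaiChiOne 1) (√(p.2 * (1 / 2 - p.1) / (p.1 * (1 / 2 - p.2)))))) p := by
  rw [lintegral_pairFun_eq_dens measurable_lovasAndaiChiOne,
    lintegral_pairFun_eq_dens measurable_const, lintegral_dens_mul_chiOne,
    lintegral_dens_mul_chiOne_one]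
  have hD : 0 ≤ ∫ γ in Ioi 0, dens γ := by
    rw [integral_dens]; exact Y_four_zero_pos.le
  have hc : 0 ≤ (lovasAndaiChiOne 1).toReal := ENNReal.toReal_nonneg
  rw [show (64 : ℝ≥0∞) = ENNReal.ofReal 64 by norm_num, show (29 : ℝ≥0∞) = ENNReal.ofReal 29 by norm_num,
    ← mul_assoc, ← mul_assoc, ← ENNReal.ofReal_mul (by norm_num), ← ENNReal.ofReal_mul (by norm_num),
    ← ENNReal.ofReal_mul (by positivity), ← ENNReal.ofReal_mul (by positivity)]
  congr 1
  ring

end LovasAndai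

/-- **Lovas–Andai 2017, Corollary 2 with Theorem 2 on the maximally mixed fibre** (`29/64`).
[cite: LovasAndai2017, Corollary 2 and Theorem 2] -/
theorem LovasAndai2017_rebit_fibre_separability_probability_holds :
    LovasAndai2017_rebit_fibre_separability_probability :=
  LovasAndai.rebit_fibre_separability_probability_of_eigenIntegral LovasAndai.eigenPair_identity

/-- **Lovas–Andai 2017, Theorem 2: the two-rebit Hilbert–Schmidt separability probability is
`29/64`.** [cite: LovasAndai2017, Theorem 2] -/
theorem LovasAndai2017_rebit_separability_probability_holds :
    LovasAndai2017_rebit_separability_probability :=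
  LovasAndai2017.rebit_separability_probability_of_fibre
    LovasAndai2017_rebit_fibre_separability_probability_holds

end Literature.Probability.RandomMatrix

end
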